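import Summits.CriticalPhenomena.PercolationContinuityZ3.Theorems.PercNecklaceBackboneTruncatedSusceptibilityFiniteOfThetaOfCritical
import HarnessLib

/-!
# Crux `TruncatedSusceptibilityFiniteOfTheta` (stmt-CriticalPhenomena-0852): the registered open stub
# `stub_criticalRadiusMoment` from POLYNOMIAL thin critical dust

Lead prover-line-stmt-CriticalPhenomena-0852-c2-0 (line `registered`, continuation c2), 2026-08-17.
Bookkeeping reductions recording where the residual stub of this crux sits among the jump-world
"thin critical dust" statements used by the sibling cruxes of `PercolationContinuityZ3`:

* `stub_criticalRadiusMoment_of_rpow_decay` — it suffices that, in the jump world `θ(p_c(ℤ³)) > 0`, the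
  truncated one-arm probability `P_{p_c}(0 ↔ ∂B(n), |C(0)| < ∞)` is `O((n+1)^{-(3+η)})` for SOME `η > 0`
  (the minimal polynomial rate: `(n+1)² · C (n+1)^{-(3+η)} = C (n+1)^{-(1+η)}` is summable);
* `stub_criticalRadiusMoment_of_thinDust` — hence from THIN DUST, the hypothesis of
  `Theorems.jumpFireBreak_of_thinDust` (crux `PercBurnResprinkle.JumpFireBreak`, stmt-CriticalPhenomena-7204:
  decay faster than every polynomial), taken verbatim;
* `TruncatedSusceptibilityFiniteOfTheta_of_thinDust` / `…_of_rpow_decay` — so the crux itself follows from either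
  (through the landed `TruncatedSusceptibilityFiniteOfTheta_of_criticalRadiusMoment`, p150587).

So the open inputs of 0852 (this stub), 7204 (`stub_thinDust`) and 0853 (`FiniteRadiusExpDecayOfTheta` at `p = p_c`)
are nested: `0853@p_c ⇒ thin dust ⇒ O(n^{-3-η}) ⇒ stub_criticalRadiusMoment ⇒ L(p_c) ⇔ crux 0852`
(`TruncatedSusceptibilityFiniteOfTheta_iff_critical`). No new definitions; pure real analysis over landed files.
-/

noncomputable section

namespace Summit.CriticalPhenomena.PercolationContinuityZ3.Theorems.TruncatedSusceptibilityFiniteOfTheta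

open MeasureTheory Literature.Probability.Percolation Literature.Probability.LatticeModels

/-- **Polynomial thin dust of order `3 + η` gives the registered stub `stub_criticalRadiusMoment`.**
If `θ(p_c(ℤ³)) > 0` implies `P_{p_c}(0 ↔ ∂B(n), |C(0)| < ∞) ≤ C (n+1)^{-(3+η)}` for all `n`, for some `C` and
some `η > 0`, then `θ(p_c) > 0` implies `Σ_n (n+1)² P_{p_c}(0 ↔ ∂B(n), |C(0)| < ∞) < ∞`: the series is dominated
by `C (n+1)^{-(1+η)}`, a convergent `p`-series. [folklore] -/
theorem stub_criticalRadiusMoment_of_rpow_decay : (0 < theta (zdGraph 3) (0 : Site 3) (criticalProbI 3) → ∃ η : ℝ, 0 < η ∧ ∃ C : ℝ, ∀ n : ℕ, (bondPercolation (zdGraph 3) (criticalProbI 3)).real (siteToBoundary 3 n \ percolatesAt 0) ≤ C * ((n : ℝ) + 1) ^ (-(3 + η))) → 0 < theta (zdGraph 3) (0 : Site 3) (criticalProbI 3) → Summable fun n : ℕ => ((n : ℝ) + 1) ^ 2 * (bondPercolation (zdGraph 3) (criticalProbI 3)).real (siteToBoundary 3 n \ percolatesAt 0) := by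
  intro hdecay hθ
  obtain ⟨η, hη, C, hC⟩ := hdecay hθ
  -- the dominating series `C (n+1)^{-(1+η)}`
  have hp : Summable fun n : ℕ => ((n : ℝ) + 1) ^ (-(1 + η)) := by
    have h := (Real.summable_nat_rpow.2 (show -(1 + η) < -1 by linarith))
    have h' := (summable_nat_add_iff 1).2 h
    refine h'.congr fun n => ?_
    push_cast
    ring_nf
  have hdom : Summable fun n : ℕ => C * ((n : ℝ) + 1) ^ (-(1 + η)) := hp.mul_left C
  refine hdom.of_nonneg_of_le (fun n => mul_nonneg (by positivity) measureReal_nonneg) fun n => ?_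
  have hn : (0 : ℝ) < (n : ℝ) + 1 := by positivity
  calc ((n : ℝ) + 1) ^ 2 * (bondPercolation (zdGraph 3) (criticalProbI 3)).real (siteToBoundary 3 n \ percolatesAt 0)
      ≤ ((n : ℝ) + 1) ^ 2 * (C * ((n : ℝ) + 1) ^ (-(3 + η))) :=
        mul_le_mul_of_nonneg_left (hC n) (by positivity)
    _ = C * (((n : ℝ) + 1) ^ (2 : ℝ) * ((n : ℝ) + 1) ^ (-(3 + η))) := by
        rw [Real.rpow_two]; ring
    _ = C * ((n : ℝ) + 1) ^ (-(1 + η)) := by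
        rw [← Real.rpow_add hn]; congr 2; ring

/-- **Thin dust gives the registered stub.** The hypothesis is verbatim that of
`Theorems.jumpFireBreak_of_thinDust` (crux stmt-CriticalPhenomena-7204's open stub `stub_thinDust`): in the jump
world the truncated one-arm at `p_c` decays faster than every polynomial. Taking `k = 4` gives the rate
`C/(n+1)^4 = C (n+1)^{-(3+1)}` of `stub_criticalRadiusMoment_of_rpow_decay`. [folklore] -/
theorem stub_criticalRadiusMoment_of_thinDust : (0 < theta (zdGraph 3) (0 : Fin 3 → ℤ) (criticalProbI 3) → ∀ k : ℕ, ∃ C : ℝ, ∀ n : ℕ, (bondPercolation (zdGraph 3) (criticalProbI 3)).real (siteToBoundary 3 n \ percolatesAt 0) ≤ C / ((n : ℝ) + 1) ^ k) → 0 < theta (zdGraph 3) (0 : Site 3) (criticalProbI 3) → Summable fun n : ℕ => ((n : ℝ) + 1) ^ 2 * (bondPercolation (zdGraph 3) (criticalProbI 3)).real (siteToBoundary 3 n \ percolatesAt 0) := by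
  intro hdust
  refine stub_criticalRadiusMoment_of_rpow_decay fun hθ => ⟨1, one_pos, ?_⟩
  obtain ⟨C, hC⟩ := hdust hθ 4
  refine ⟨C, fun n => (hC n).trans_eq ?_⟩
  have hn : (0 : ℝ) < (n : ℝ) + 1 := by positivity
  rw [div_eq_mul_inv, ← Real.rpow_natCast, ← Real.rpow_neg hn.le]
  norm_num

/-- **The crux from polynomial thin dust of order `3 + η`** (through the landed reduction
`TruncatedSusceptibilityFiniteOfTheta_of_criticalRadiusMoment`, p150587). [folklore] -/
theorem TruncatedSusceptibilityFiniteOfTheta_of_rpow_decay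
    (hdecay : 0 < theta (zdGraph 3) (0 : Site 3) (criticalProbI 3) →
      ∃ η : ℝ, 0 < η ∧ ∃ C : ℝ, ∀ n : ℕ,
        (bondPercolation (zdGraph 3) (criticalProbI 3)).real (siteToBoundary 3 n \ percolatesAt 0) ≤
          C * ((n : ℝ) + 1) ^ (-(3 + η))) :
    Summit.CriticalPhenomena.PercolationContinuityZ3.Theses.PercNecklaceBackbone.TruncatedSusceptibilityFiniteOfTheta :=
  TruncatedSusceptibilityFiniteOfTheta_of_criticalRadiusMoment (stub_criticalRadiusMoment_of_rpow_decay hdecay)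

/-- **The crux from thin dust** (the open input of crux stmt-CriticalPhenomena-7204, verbatim): crux 0852 is
weaker than `stub_thinDust`. [folklore] -/
theorem TruncatedSusceptibilityFiniteOfTheta_of_thinDust
    (hdust : 0 < theta (zdGraph 3) (0 : Fin 3 → ℤ) (criticalProbI 3) →
      ∀ k : ℕ, ∃ C : ℝ, ∀ n : ℕ,
        (bondPercolation (zdGraph 3) (criticalProbI 3)).real (siteToBoundary 3 n \ percolatesAt 0) ≤
          C / ((n : ℝ) + 1) ^ k) :
    Summit.CriticalPhenomena.PercolationContinuityZ3.Theses.PercNecklaceBackbone.TruncatedSusceptibilityFiniteOfTheta :=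
  TruncatedSusceptibilityFiniteOfTheta_of_criticalRadiusMoment (stub_criticalRadiusMoment_of_thinDust hdust)

/-- The same for the crux's home-route spelling (`PercTruncatedSusceptibility`, shared item, identical text). [folklore] -/
theorem TruncatedSusceptibilityFiniteOfTheta_of_thinDust'
    (hdust : 0 < theta (zdGraph 3) (0 : Fin 3 → ℤ) (criticalProbI 3) →
      ∀ k : ℕ, ∃ C : ℝ, ∀ n : ℕ,
        (bondPercolation (zdGraph 3) (criticalProbI 3)).real (siteToBoundary 3 n \ percolatesAt 0) ≤
          C / ((n : ℝ) + 1) ^ k) :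
    Summit.CriticalPhenomena.PercolationContinuityZ3.Theses.PercTruncatedSusceptibility.TruncatedSusceptibilityFiniteOfTheta :=
  TruncatedSusceptibilityFiniteOfTheta_of_thinDust hdust

end Summit.CriticalPhenomena.PercolationContinuityZ3.Theorems.TruncatedSusceptibilityFiniteOfTheta

end
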